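import Summits.KontsevichZagierPeriods.Zeta5Search.Barrier.ConeGammaCuspPeriodExtensionFree
import Literature.Analysis.Convex.BasicOptimumSolution

/-!
# ζ(5) search — BARRIER: THE RAYS OF THE RATE ARRANGEMENT — a positive chamber functional is positive at a RAY of its chamber

HONEST FRAMING (cell `pub-zeta5`): systematic search; no irrationality claim unless kernel-certified. MODEL objects
under Brown–Zudilin's (28)+(30) accounting ([BZ22] = arXiv:2210.03391; (28) observed, not proved); nothing here is a
statement about `ζ(5)`, any `γ` of record, the cone's supremum (C2 OPEN) or the value / sign of the cusp slope or of
a chamber weight at a named direction (DATA of the cell); no ray, weight or value at a named direction enters the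
kernel; S-E stays CONJECTURED; records in print UNMOVED. Prover P2 g35, item «THE RAY CRITERION AND THE ORDER-TYPE
FORM», file (1) (theorems only; pure linear geometry of the 28 rates `r_k(δ) = φ_k(δ)/h_k(a)` on `ℝ⁸`, no period data).

THE POINT. The cusp slope is linear on each closed chamber `C(δ₀) = {δ : ρ₀ k < ρ₀ l ⇒ r_k(δ) ≤ r_l(δ)}` of the rate
arrangement `{r_k = r_l}` (P2 g29/g31), every chamber contains the radial line `ℝ·s(a)` (all 28 rates of `s(a)` are
`1`) and is pointed modulo that line. P2 g29's per-chamber generator test and P2 g32/g33's cone certificates take the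
GENERATORS of a chamber as data; this file identifies them intrinsically and proves the one fact a complete V-side
criterion needs:
* `eq_zero_of_forall_phiForm_eq_zero`, `eq_smul_sParam_of_forall_rate_eq` — the 28 forms separate `ℝ⁸`; a
  displacement with all 28 rates equal is radial;
* a RAY of the arrangement (written out in every statement, no definition): a displacement `x` with two distinct
  rates whose TIE PATTERN IS RIGID — every displacement `d` preserving all ties of `x` (`r_k(x) = r_l(x) ⇒ r_k(d) =
  r_l(d)`) lies in `span{x, s(a)}`; equivalently `x` spans an extreme ray of each closed chamber containing it, modulo
  `ℝ·s(a)`; `ray_smul_add_smul_sParam` — rays are stable under `x ↦ u•x + t•s(a)`, `u ≠ 0`;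
* **`exists_ray_pos_of_pos`** — for a generic reference `δ₀` and ANY weights `W` with `Σ_k W_k = 0`: if the chamber
  functional `Σ_k W_k·r_k` is positive somewhere on the closed chamber of `δ₀`, it is positive — indeed maximal per unit
  rate spread — at a RAY of that chamber, normalised to rates in `[0, 1]`. Engine: the tree's
  `Literature.Analysis.Convex.BasicOptimumSolution.exists_optimum_determined_by_tight_rows` (Schrijver 1986 §8.5 (23))
  on the polytope `{gaps ≥ 0, r_m = 0, r_M − r_m ≤ 1}` (`m`, `M` the slowest / fastest form of `δ₀`), attainment by
  `LPDuality.exists_isMaxOn_of_forall_le` (Cor. 7.1g); a vertex with positive value has its normalising row tight, and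
  «tight rows determine the point» is exactly «the tie pattern is rigid».
NOT here: the cusp slope (file (2) takes `W =` the chamber weights), any count of rays, any ray at a named direction.
-/

noncomputable section

open Set MeasureTheory Finset Matrix
open scoped Topology

namespace Summit.KontsevichZagierPeriods.Zeta5Search.Barrier.ConeGamma

/-! ### The 28 forms separate `ℝ⁸`; the radial line -/

/-- **The 28 forms separate displacements**: `φ_k(d) = 0` for all `k` forces `d = 0` (the forms `s₁+s₂, s₂+s₃, s₁+s₃`
give `s₁ = s₂ = s₃ = 0`, then `s₀ − s₂`, `s₁ + s_j`). -/
theorem eq_zero_of_forall_phiForm_eq_zero {d : Fin 8 → ℝ} (h : ∀ k, phiForm d k = 0) : d = 0 := by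
  have e : ∀ k, pairForm d (fstIdx k) (sndIdx k) = 0 := fun k => by rw [← phiForm_eq]; exact h k
  have h0 : pairForm d 1 2 = 0 := e 0; have h1 : pairForm d 0 2 = 0 := e 1; have h2 : pairForm d 2 3 = 0 := e 2
  have h8 : pairForm d 1 3 = 0 := e 8; have h9 : pairForm d 1 4 = 0 := e 9; have h10 : pairForm d 1 5 = 0 := e 10
  have h20 : pairForm d 1 6 = 0 := e 20; have h21 : pairForm d 1 7 = 0 := e 21
  simp only [pairForm, if_false, if_true,
    show (2 : Fin 8) ≠ 0 from by decide, show (3 : Fin 8) ≠ 0 from by decide, show (4 : Fin 8) ≠ 0 from by decide,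
    show (5 : Fin 8) ≠ 0 from by decide, show (6 : Fin 8) ≠ 0 from by decide, show (7 : Fin 8) ≠ 0 from by decide,
    show (1 : Fin 8) ≠ 0 from by decide] at h0 h1 h2 h8 h9 h10 h20 h21
  ext p
  fin_cases p <;> simp <;> linarith

/-- **A displacement with all 28 rates equal to `c` is `c•s(a)`** (all forms of `a` positive). -/
theorem eq_smul_sParam_of_forall_rate_eq {a : Dir} (hpos : ∀ k, 0 < h28 a k) {d : Fin 8 → ℝ} {c : ℝ}
    (h : ∀ k, phiForm d k / h28 a k = c) : d = c • sParam a := by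
  have h0 : d - c • sParam a = 0 := by
    refine eq_zero_of_forall_phiForm_eq_zero fun k => ?_
    rw [sub_eq_add_neg, ← neg_smul, phiForm_add, phiForm_smul_sParam]
    have := h k; rw [div_eq_iff (hpos k).ne'] at this; linarith
  exact sub_eq_zero.mp h0

/-- The rates of `u•x + t•s(a)`: `r_k(u•x + t•s(a)) = u·r_k(x) + t`. -/
theorem rate_smul_add_smul_sParam {a : Dir} (hpos : ∀ k, 0 < h28 a k) (x : Fin 8 → ℝ) (u t : ℝ) (k : Fin 28) :
    phiForm (u • x + t • sParam a) k / h28 a k = u * (phiForm x k / h28 a k) + t := by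
  rw [phiForm_add, phiForm_smul, phiForm_smul_sParam, add_div, mul_div_assoc, mul_div_assoc,
    div_self (hpos k).ne', mul_one]

/-! ### Rays: stability under the radial gauge and scaling -/

/-- **Rays are stable under `x ↦ u•x + t•s(a)`, `u ≠ 0`**: the tie pattern is unchanged and stays rigid. (A ray: two
distinct rates, and every tie-preserving displacement lies in `span{x, s(a)}`.) -/
theorem ray_smul_add_smul_sParam {a : Dir} (hpos : ∀ k, 0 < h28 a k) {x : Fin 8 → ℝ}
    (hx : (∃ k l, phiForm x k / h28 a k ≠ phiForm x l / h28 a l) ∧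
      ∀ d : Fin 8 → ℝ, (∀ k l, phiForm x k / h28 a k = phiForm x l / h28 a l →
        phiForm d k / h28 a k = phiForm d l / h28 a l) → ∃ u t : ℝ, d = u • x + t • sParam a)
    {u : ℝ} (hu : u ≠ 0) (t : ℝ) :
    (∃ k l, phiForm (u • x + t • sParam a) k / h28 a k ≠ phiForm (u • x + t • sParam a) l / h28 a l) ∧
      ∀ d : Fin 8 → ℝ, (∀ k l, phiForm (u • x + t • sParam a) k / h28 a k =
          phiForm (u • x + t • sParam a) l / h28 a l → phiForm d k / h28 a k = phiForm d l / h28 a l) →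
        ∃ u' t' : ℝ, d = u' • (u • x + t • sParam a) + t' • sParam a := by
  obtain ⟨⟨k, l, hkl⟩, hrig⟩ := hx
  refine ⟨⟨k, l, fun h => hkl ?_⟩, fun d hd => ?_⟩
  · rw [rate_smul_add_smul_sParam hpos, rate_smul_add_smul_sParam hpos] at h
    exact mul_left_cancel₀ hu (by linarith)
  · obtain ⟨u', t', rfl⟩ := hrig d fun k l h => hd k l (by
      rw [rate_smul_add_smul_sParam hpos, rate_smul_add_smul_sParam hpos, h])
    refine ⟨u' / u, t' - u' / u * t, ?_⟩
    ext p
    simp only [Pi.add_apply, Pi.smul_apply, smul_eq_mul]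
    field_simp; ring

/-- **Two rays with the same tie pattern differ by the gauge**: if `x`, `x'` are rays and every tie of `x` is a tie of
`x'`, then `x' = u•x + t•s(a)` with `u ≠ 0`. -/
theorem ray_eq_smul_add_smul_of_ties {a : Dir} (hpos : ∀ k, 0 < h28 a k) {x x' : Fin 8 → ℝ}
    (hx : ∀ d : Fin 8 → ℝ, (∀ k l, phiForm x k / h28 a k = phiForm x l / h28 a l →
        phiForm d k / h28 a k = phiForm d l / h28 a l) → ∃ u t : ℝ, d = u • x + t • sParam a)
    (hx' : ∃ k l, phiForm x' k / h28 a k ≠ phiForm x' l / h28 a l)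
    (hties : ∀ k l, phiForm x k / h28 a k = phiForm x l / h28 a l → phiForm x' k / h28 a k = phiForm x' l / h28 a l) :
    ∃ u t : ℝ, u ≠ 0 ∧ x' = u • x + t • sParam a := by
  obtain ⟨u, t, rfl⟩ := hx x' hties
  refine ⟨u, t, fun hu => ?_, rfl⟩
  obtain ⟨k, l, hkl⟩ := hx'
  rw [rate_smul_add_smul_sParam hpos, rate_smul_add_smul_sParam hpos, hu, zero_mul, zero_mul] at hkl
  exact hkl rfl

/-- **The rank form of rigidity** (what a desk checks): if `r_k(x) ≠ r_l(x)`, the tie pattern of `x` is rigid iff the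
only tie-preserving displacement `d` with `r_k(d) = r_l(d) = 0` is `d = 0` (i.e. the tie equations of `x` together with
`r_k = 0`, `r_l = 0` have full rank `8`). -/
theorem ray_iff_tie_kernel {a : Dir} (hpos : ∀ k, 0 < h28 a k) {x : Fin 8 → ℝ} {k₀ l₀ : Fin 28}
    (hkl : phiForm x k₀ / h28 a k₀ ≠ phiForm x l₀ / h28 a l₀) :
    (∀ d : Fin 8 → ℝ, (∀ k l, phiForm x k / h28 a k = phiForm x l / h28 a l →
        phiForm d k / h28 a k = phiForm d l / h28 a l) → ∃ u t : ℝ, d = u • x + t • sParam a) ↔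
      ∀ d : Fin 8 → ℝ, (∀ k l, phiForm x k / h28 a k = phiForm x l / h28 a l →
        phiForm d k / h28 a k = phiForm d l / h28 a l) →
        phiForm d k₀ / h28 a k₀ = 0 → phiForm d l₀ / h28 a l₀ = 0 → d = 0 := by
  constructor
  · intro h d hd hk hl
    obtain ⟨u, t, rfl⟩ := h d hd
    rw [rate_smul_add_smul_sParam hpos] at hk hl
    have hu : u = 0 := by
      by_contra hu
      exact hkl (mul_left_cancel₀ hu (by linarith))
    rw [hu, zero_mul, zero_add] at hk
    rw [hu, hk, zero_smul, zero_smul, add_zero]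
  · intro h d hd
    obtain ⟨u, hu⟩ : ∃ u : ℝ, u = (phiForm d k₀ / h28 a k₀ - phiForm d l₀ / h28 a l₀) /
        (phiForm x k₀ / h28 a k₀ - phiForm x l₀ / h28 a l₀) := ⟨_, rfl⟩
    obtain ⟨t, ht⟩ : ∃ t : ℝ, t = phiForm d k₀ / h28 a k₀ - u * (phiForm x k₀ / h28 a k₀) := ⟨_, rfl⟩
    have hr : ∀ k, phiForm (d + (-u) • x + (-t) • sParam a) k / h28 a k =
        phiForm d k / h28 a k - u * (phiForm x k / h28 a k) - t := fun k => by
      rw [add_assoc, phiForm_add, add_div, rate_smul_add_smul_sParam hpos]; ring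
    have h0 := h (d + (-u) • x + (-t) • sParam a) (fun k l he => by rw [hr, hr, hd k l he, he])
      (by rw [hr, ht]; ring) (by
        rw [hr, ht]
        have hne : phiForm x k₀ / h28 a k₀ - phiForm x l₀ / h28 a l₀ ≠ 0 := sub_ne_zero.mpr hkl
        have : u * (phiForm x k₀ / h28 a k₀ - phiForm x l₀ / h28 a l₀) =
            phiForm d k₀ / h28 a k₀ - phiForm d l₀ / h28 a l₀ := by rw [hu, div_mul_cancel₀ _ hne]
        linarith)
    refine ⟨u, t, ?_⟩
    have := congrArg (fun v => v + u • x + t • sParam a) h0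
    simp only [zero_add] at this
    rw [← this]
    ext p
    simp only [Pi.add_apply, Pi.smul_apply, smul_eq_mul, neg_mul]
    ring

/-! ### A positive chamber functional is positive at a ray of the chamber -/

/-- **A POSITIVE CHAMBER FUNCTIONAL IS POSITIVE AT A RAY OF ITS CHAMBER** (Schrijver 1986 §8.5 (23) via the tree's
`BasicOptimumSolution.exists_optimum_determined_by_tight_rows`, attainment by `LPDuality.exists_isMaxOn_of_forall_le`).
All 28 forms of `a` positive, `δ₀` a generic reference, `W` any weights with `Σ_k W_k = 0` (so the functional
`Σ_k W_k·r_k` kills `s(a)`). If `Σ_k W_k·r_k(δ) > 0` for some `δ` in the closed chamber of `δ₀` (`δ` refined by `δ₀`), then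
`Σ_k W_k·r_k(x) > 0` at some `x` in the same closed chamber which is a RAY of the rate arrangement — two distinct rates and
a RIGID tie pattern: every tie-preserving displacement lies in `span{x, s(a)}` — normalised to rates in `[0, 1]`, and
MAXIMISING the functional over the whole closed chamber cut to rate spread `≤ 1` (the steepest normalised ascent of a
chamber functional sits at a ray). PROOF SHAPE (re-derivable by hand): maximise over the polytope `{δ : r_k(δ) ≤ r_l(δ)
(ρ₀ k < ρ₀ l), r_m(δ) = 0, r_M(δ) − r_m(δ) ≤ 1}`, `m` / `M` the slowest / fastest form of `δ₀`; it is POINTED because a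
`d` killed by all rows has all 28 rates equal (genericity chains the pairs) and `r_m(d) = 0`, so `d = 0` as the 28 forms
separate `ℝ⁸`; the objective is bounded (rates in `[0,1]`), so it is attained, and at a basic optimum with positive value
the row `r_M − r_m ≤ 1` is tight (else `x` itself is a non-zero solution of the tight homogeneous system); «the tight
rows determine `x`» then reads: a tie-preserving `d` minus `(r_M(d) − r_m(d))•x + r_m(d)•s(a)` solves the tight system,
hence vanishes. Nothing about the cusp slope here (file (2) takes `W =` the chamber weights); no instance at a named
direction. -/
theorem exists_ray_pos_of_pos {a : Dir} (hpos : ∀ k, 0 < h28 a k) {δ₀ : Fin 8 → ℝ}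
    (hgen : ∀ k l : Fin 28, k ≠ l → phiForm δ₀ k / h28 a k ≠ phiForm δ₀ l / h28 a l)
    {W : Fin 28 → ℝ} (hW : ∑ k, W k = 0) {δ : Fin 8 → ℝ}
    (href : ∀ k l : Fin 28, phiForm δ k / h28 a k < phiForm δ l / h28 a l →
      phiForm δ₀ k / h28 a k < phiForm δ₀ l / h28 a l)
    (hval : 0 < ∑ k, W k * (phiForm δ k / h28 a k)) :
    ∃ x : Fin 8 → ℝ, (∀ k l : Fin 28, phiForm x k / h28 a k < phiForm x l / h28 a l →
        phiForm δ₀ k / h28 a k < phiForm δ₀ l / h28 a l) ∧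
      (∀ k, 0 ≤ phiForm x k / h28 a k ∧ phiForm x k / h28 a k ≤ 1) ∧
      ((∃ k l, phiForm x k / h28 a k ≠ phiForm x l / h28 a l) ∧
        ∀ d : Fin 8 → ℝ, (∀ k l, phiForm x k / h28 a k = phiForm x l / h28 a l →
          phiForm d k / h28 a k = phiForm d l / h28 a l) → ∃ u t : ℝ, d = u • x + t • sParam a) ∧
      (∀ y : Fin 8 → ℝ, (∀ k l : Fin 28, phiForm y k / h28 a k < phiForm y l / h28 a l →
          phiForm δ₀ k / h28 a k < phiForm δ₀ l / h28 a l) →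
        (∀ k l, phiForm y k / h28 a k - phiForm y l / h28 a l ≤ 1) →
        ∑ k, W k * (phiForm y k / h28 a k) ≤ ∑ k, W k * (phiForm x k / h28 a k)) ∧
      0 < ∑ k, W k * (phiForm x k / h28 a k) := by
  classical
  -- rates as dot products with fixed vectors
  obtain ⟨n, hn⟩ : ∃ n : Fin 28 → Fin 8 → ℝ, ∀ k p, n k p = phiForm (Pi.single p (1 : ℝ)) k / h28 a k :=
    ⟨_, fun _ _ => rfl⟩
  have hrate : ∀ (y : Fin 8 → ℝ) k, n k ⬝ᵥ y = phiForm y k / h28 a k := fun y k => by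
    rw [rate_eq_sum_coord a y k, dotProduct]
    exact Finset.sum_congr rfl fun p _ => by rw [hn, mul_comm]
  -- the objective vector
  obtain ⟨c, hc⟩ : ∃ c : Fin 8 → ℝ, ∀ p, c p = ∑ k, W k * (phiForm (Pi.single p (1 : ℝ)) k / h28 a k) :=
    ⟨_, fun _ => rfl⟩
  have hobj : ∀ y : Fin 8 → ℝ, c ⬝ᵥ y = ∑ k, W k * (phiForm y k / h28 a k) := fun y => by
    rw [sum_mul_rate_eq_sum_coord a W y, dotProduct]
    exact Finset.sum_congr rfl fun p _ => by rw [hc, mul_comm]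
  -- the slowest and the fastest form of `δ₀`
  obtain ⟨m, -, hm⟩ := Finset.exists_min_image Finset.univ (fun k => phiForm δ₀ k / h28 a k) Finset.univ_nonempty
  obtain ⟨M, -, hM⟩ := Finset.exists_max_image Finset.univ (fun k => phiForm δ₀ k / h28 a k) Finset.univ_nonempty
  have hm' : ∀ k, k ≠ m → phiForm δ₀ m / h28 a m < phiForm δ₀ k / h28 a k := fun k hk =>
    lt_of_le_of_ne (hm k (Finset.mem_univ _)) (hgen m k (Ne.symm hk))
  have hM' : ∀ k, k ≠ M → phiForm δ₀ k / h28 a k < phiForm δ₀ M / h28 a M := fun k hk =>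
    lt_of_le_of_ne (hM k (Finset.mem_univ _)) (hgen k M hk)
  have hmM : m ≠ M := by
    intro h
    obtain ⟨k₀, hk₀⟩ : ∃ k₀ : Fin 28, k₀ ≠ m := ⟨if m = 0 then 1 else 0, by split_ifs with h0 <;> simp [h0, Ne.symm]⟩
    exact lt_asymm (hm' k₀ hk₀) (h ▸ hM' k₀ (h ▸ hk₀))
  have hmM' : phiForm δ₀ m / h28 a m < phiForm δ₀ M / h28 a M := hm' M (Ne.symm hmM)
  -- on the closed chamber: `r_m ≤ r_k ≤ r_M`
  have hsand : ∀ y : Fin 8 → ℝ, (∀ k l : Fin 28, phiForm δ₀ k / h28 a k < phiForm δ₀ l / h28 a l →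
      phiForm y k / h28 a k ≤ phiForm y l / h28 a l) → ∀ k,
      phiForm y m / h28 a m ≤ phiForm y k / h28 a k ∧ phiForm y k / h28 a k ≤ phiForm y M / h28 a M := by
    intro y hy k
    refine ⟨?_, ?_⟩
    · by_cases hk : k = m; · rw [hk]
      exact hy m k (hm' k hk)
    · by_cases hk : k = M; · rw [hk]
      exact hy k M (hM' k hk)
  -- the rows of the polytope `{gaps ≥ 0, r_m = 0, r_M − r_m ≤ 1}`
  obtain ⟨arow, harow⟩ : ∃ arow : (Fin 28 × Fin 28) ⊕ Fin 3 → Fin 8 → ℝ, arow =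
      Sum.elim (fun kl : Fin 28 × Fin 28 =>
        if phiForm δ₀ kl.1 / h28 a kl.1 < phiForm δ₀ kl.2 / h28 a kl.2 then n kl.1 - n kl.2 else 0)
        ![n m, -n m, n M - n m] := ⟨_, rfl⟩
  obtain ⟨brow, hbrow⟩ : ∃ brow : (Fin 28 × Fin 28) ⊕ Fin 3 → ℝ, brow = Sum.elim (fun _ => 0) ![0, 0, 1] := ⟨_, rfl⟩
  -- feasibility, read both ways
  have feas_of : ∀ y : Fin 8 → ℝ, (∀ k l : Fin 28, phiForm δ₀ k / h28 a k < phiForm δ₀ l / h28 a l →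
      phiForm y k / h28 a k ≤ phiForm y l / h28 a l) → phiForm y m / h28 a m = 0 → phiForm y M / h28 a M ≤ 1 →
      ∀ i, arow i ⬝ᵥ y ≤ brow i := by
    intro y hy hym hyM i
    rcases i with ⟨k, l⟩ | j
    · simp only [harow, hbrow, Sum.elim_inl]
      split_ifs with hkl
      · rw [sub_dotProduct, hrate, hrate, sub_nonpos]; exact hy k l hkl
      · rw [zero_dotProduct]
    · fin_cases j
      · simp [harow, hbrow, hrate, hym]
      · simp [harow, hbrow, neg_dotProduct, hrate, hym]
      · simp [harow, hbrow, sub_dotProduct, hrate, hym, hyM]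
  have of_feas : ∀ y : Fin 8 → ℝ, (∀ i, arow i ⬝ᵥ y ≤ brow i) →
      (∀ k l : Fin 28, phiForm δ₀ k / h28 a k < phiForm δ₀ l / h28 a l →
        phiForm y k / h28 a k ≤ phiForm y l / h28 a l) ∧ phiForm y m / h28 a m = 0 ∧ phiForm y M / h28 a M ≤ 1 := by
    intro y hy
    have h0 := hy (Sum.inr 0)
    have h1 := hy (Sum.inr 1)
    have h2 := hy (Sum.inr 2)
    simp only [harow, hbrow, Sum.elim_inr, Matrix.cons_val_zero, Matrix.cons_val_one, Matrix.cons_val_two,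
      Matrix.tail_cons, Matrix.head_cons, neg_dotProduct, sub_dotProduct, hrate] at h0 h1 h2
    have hym : phiForm y m / h28 a m = 0 := le_antisymm h0 (by linarith)
    refine ⟨fun k l hkl => ?_, hym, by linarith⟩
    have h := hy (Sum.inl (k, l))
    simp only [harow, hbrow, Sum.elim_inl, if_pos hkl, sub_dotProduct, hrate] at h
    linarith
  -- the polytope is pointed
  have hA : ∀ d : Fin 8 → ℝ, (∀ i, arow i ⬝ᵥ d = 0) → d = 0 := by
    intro d hd
    have hdm : phiForm d m / h28 a m = 0 := by
      simpa only [harow, Sum.elim_inr, Matrix.cons_val_zero, hrate] using hd (Sum.inr 0)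
    have hall : ∀ k, phiForm d k / h28 a k = 0 := fun k => by
      by_cases hk : k = m; · rw [hk]; exact hdm
      have h := hd (Sum.inl (m, k))
      simp only [harow, Sum.elim_inl, if_pos (hm' k hk), sub_dotProduct, hrate] at h
      linarith
    have h := eq_smul_sParam_of_forall_rate_eq hpos hall
    rwa [zero_smul] at h
  -- a feasible point with positive value: normalise `δ`
  have hrefle : ∀ k l : Fin 28, phiForm δ₀ k / h28 a k < phiForm δ₀ l / h28 a l →
      phiForm δ k / h28 a k ≤ phiForm δ l / h28 a l := fun k l hkl => rate_le_rate_of_refines href hkl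
  obtain ⟨g, hg⟩ : ∃ g : ℝ, g = phiForm δ M / h28 a M - phiForm δ m / h28 a m := ⟨_, rfl⟩
  have hgpos : 0 < g := by
    rcases (sub_nonneg.mpr (hrefle m M hmM')).eq_or_lt with h | h
    · -- all rates of `δ` equal ⇒ the value is `r·ΣW = 0`
      exfalso
      have hall : ∀ k, phiForm δ k / h28 a k = phiForm δ m / h28 a m := fun k =>
        le_antisymm (by linarith [(hsand δ hrefle k).2]) (hsand δ hrefle k).1
      have : ∑ k, W k * (phiForm δ k / h28 a k) = 0 := by
        simp_rw [hall, ← Finset.sum_mul, hW, zero_mul]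
      linarith
    · rwa [hg]
  obtain ⟨x₁, hx₁⟩ : ∃ x₁ : Fin 8 → ℝ, x₁ = g⁻¹ • δ + (-(g⁻¹ * (phiForm δ m / h28 a m))) • sParam a := ⟨_, rfl⟩
  have hx₁r : ∀ k, phiForm x₁ k / h28 a k = g⁻¹ * (phiForm δ k / h28 a k - phiForm δ m / h28 a m) := fun k => by
    rw [hx₁, rate_smul_add_smul_sParam hpos]; ring
  have hx₁feas : ∀ i, arow i ⬝ᵥ x₁ ≤ brow i := by
    refine feas_of x₁ (fun k l hkl => ?_) ?_ ?_
    · rw [hx₁r, hx₁r]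
      exact mul_le_mul_of_nonneg_left (by linarith [hrefle k l hkl]) (inv_pos.mpr hgpos).le
    · rw [hx₁r, sub_self, mul_zero]
    · rw [hx₁r, ← hg, inv_mul_cancel₀ hgpos.ne']
  have hx₁val : c ⬝ᵥ x₁ = g⁻¹ * ∑ k, W k * (phiForm δ k / h28 a k) := by
    rw [hobj]
    have e : ∀ k, W k * (phiForm x₁ k / h28 a k) =
        g⁻¹ * (W k * (phiForm δ k / h28 a k)) - g⁻¹ * (phiForm δ m / h28 a m) * W k := fun k => by
      rw [hx₁r]; ring
    simp_rw [e]
    rw [Finset.sum_sub_distrib, ← Finset.mul_sum, ← Finset.mul_sum, hW, mul_zero, sub_zero]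
  have hx₁pos : 0 < c ⬝ᵥ x₁ := by rw [hx₁val]; exact mul_pos (inv_pos.mpr hgpos) hval
  -- the objective is bounded on the polytope (rates in `[0,1]`)
  have hbound : ∀ y : Fin 8 → ℝ, (∀ i, arow i ⬝ᵥ y ≤ brow i) → c ⬝ᵥ y ≤ ∑ k, |W k| := by
    intro y hy
    obtain ⟨hyc, hym, hyM⟩ := of_feas y hy
    rw [hobj]
    refine Finset.sum_le_sum fun k _ => ?_
    have h01 := hsand y hyc k
    have h0 : 0 ≤ phiForm y k / h28 a k := by linarith [h01.1]
    have h1 : phiForm y k / h28 a k ≤ 1 := by linarith [h01.2]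
    calc W k * (phiForm y k / h28 a k) ≤ |W k| * (phiForm y k / h28 a k) :=
          mul_le_mul_of_nonneg_right (le_abs_self _) h0
      _ ≤ |W k| := mul_le_of_le_one_right (abs_nonneg _) h1
  -- attainment (LP duality, Cor. 7.1g) and a basic optimum solution (§8.5 (23))
  obtain ⟨xs, hxs, hxsmax⟩ := Literature.Analysis.Convex.LPDuality.exists_isMaxOn_of_forall_le (𝕜 := ℝ)
    (arow : Matrix ((Fin 28 × Fin 28) ⊕ Fin 3) (Fin 8) ℝ) brow c ⟨x₁, fun i => hx₁feas i⟩
    (fun y hy => hbound y fun i => hy i)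
  obtain ⟨x, hx, hcx, hdet⟩ :=
    Literature.Analysis.Convex.BasicOptimumSolution.exists_optimum_determined_by_tight_rows arow brow c hA
      (x₀ := xs) (fun i => hxs i) (fun y hy => hxsmax y fun i => hy i)
  have hxval : 0 < c ⬝ᵥ x := by
    rw [hcx]; exact lt_of_lt_of_le hx₁pos (hxsmax x₁ fun i => hx₁feas i)
  obtain ⟨hxc, hxm, hxM1⟩ := of_feas x hx
  -- the normalising row is tight: `r_M(x) = 1`
  have hxM : phiForm x M / h28 a M = 1 := by
    by_contra hne
    have hlt : phiForm x M / h28 a M < 1 := lt_of_le_of_ne hxM1 hne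
    have hx0 : x = 0 := hdet x fun i hi => by
      rcases i with ⟨k, l⟩ | j
      · simpa only [hbrow, Sum.elim_inl] using hi
      · fin_cases j
        · simpa [hbrow] using hi
        · simpa [hbrow] using hi
        · exfalso
          simp [harow, hbrow, sub_dotProduct, hrate, hxm] at hi
          exact hne hi
    rw [hx0, dotProduct_zero] at hxval
    exact lt_irrefl _ hxval
  refine ⟨x, refines_of_forall_rate_le hgen hxc, fun k => ?_, ⟨⟨m, M, ?_⟩, fun d hd => ?_⟩, fun y hy hy1 => ?_,
    by rwa [← hobj]⟩
  · have h := hsand x hxc k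
    rw [hxm] at h; rw [hxM] at h
    exact h
  · rw [hxm, hxM]; exact zero_ne_one
  rotate_left
  · -- maximality over the spread-normalised chamber: shift `y` to `r_m = 0`, compare with the optimum
    have hyle : ∀ k l : Fin 28, phiForm δ₀ k / h28 a k < phiForm δ₀ l / h28 a l →
        phiForm y k / h28 a k ≤ phiForm y l / h28 a l := fun k l hkl => rate_le_rate_of_refines hy hkl
    have hy'r : ∀ k, phiForm (y + (-(phiForm y m / h28 a m)) • sParam a) k / h28 a k =
        phiForm y k / h28 a k - phiForm y m / h28 a m := fun k => by
      rw [phiForm_add, add_div, phiForm_smul_sParam, mul_div_assoc, div_self (hpos k).ne', mul_one]; ring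
    have hy'feas : ∀ i, arow i ⬝ᵥ (y + (-(phiForm y m / h28 a m)) • sParam a) ≤ brow i := by
      refine feas_of _ (fun k l hkl => ?_) ?_ ?_
      · rw [hy'r, hy'r]; linarith [hyle k l hkl]
      · rw [hy'r, sub_self]
      · rw [hy'r]; exact hy1 M m
    have h1 := hxsmax _ hy'feas
    rw [← hcx, hobj, hobj] at h1
    have h2 : ∑ k, W k * (phiForm (y + (-(phiForm y m / h28 a m)) • sParam a) k / h28 a k) =
        ∑ k, W k * (phiForm y k / h28 a k) := by
      simp_rw [hy'r, mul_sub]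
      rw [Finset.sum_sub_distrib, ← Finset.sum_mul, hW, zero_mul, sub_zero]
    linarith
  · -- rigidity: subtract the components along `x` and `s(a)`, the tight rows kill the rest
    obtain ⟨α, hα⟩ : ∃ α : ℝ, α = phiForm d M / h28 a M - phiForm d m / h28 a m := ⟨_, rfl⟩
    obtain ⟨β, hβ⟩ : ∃ β : ℝ, β = phiForm d m / h28 a m := ⟨_, rfl⟩
    have hd'r : ∀ k, phiForm (d + (-α) • x + (-β) • sParam a) k / h28 a k =
        phiForm d k / h28 a k - α * (phiForm x k / h28 a k) - β := fun k => by
      rw [add_assoc, phiForm_add, add_div, rate_smul_add_smul_sParam hpos]; ring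
    have hd' : d + (-α) • x + (-β) • sParam a = 0 := by
      refine hdet _ fun i hi => ?_
      rcases i with ⟨k, l⟩ | j
      · simp only [harow, hbrow, Sum.elim_inl] at hi ⊢
        split_ifs at hi ⊢ with hkl
        · rw [sub_dotProduct, hrate, hrate, sub_eq_zero] at hi
          rw [sub_dotProduct, hrate, hrate, hd'r, hd'r, hd k l hi, hi, sub_self]
        · rw [zero_dotProduct]
      · have t0 : arow (Sum.inr 0) ⬝ᵥ (d + (-α) • x + (-β) • sParam a) = 0 := by
          simp only [harow, Sum.elim_inr, Matrix.cons_val_zero, hrate, hd'r, hxm]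
          rw [hβ]; ring
        have t1 : arow (Sum.inr 1) ⬝ᵥ (d + (-α) • x + (-β) • sParam a) = 0 := by
          simp only [harow, Sum.elim_inr, Matrix.cons_val_one, Matrix.cons_val_zero, neg_dotProduct, hrate, hd'r,
            hxm]
          rw [hβ]; ring
        have t2 : arow (Sum.inr 2) ⬝ᵥ (d + (-α) • x + (-β) • sParam a) = 0 := by
          simp only [harow, Sum.elim_inr, Matrix.cons_val_two, Matrix.tail_cons, Matrix.head_cons, sub_dotProduct,
            hrate, hd'r, hxm, hxM]
          rw [hα]; ring
        fin_cases j
        exacts [t0, t1, t2]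
    refine ⟨α, β, ?_⟩
    have := congrArg (fun v => v + α • x + β • sParam a) hd'
    simp only [zero_add] at this
    rw [← this]
    ext p
    simp only [Pi.add_apply, Pi.smul_apply, smul_eq_mul, neg_mul]
    ring

end Summit.KontsevichZagierPeriods.Zeta5Search.Barrier.ConeGamma

end
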